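import Literature.AlgebraicGeometry.HodgeTheory.WeilClassesSplitSquareZetaEight
import HarnessLib

/-!
# Deligne's `A₀ ⊗ E` for an ARBITRARY number field `E = ℚ[x]/(P)`: a non-zero ALGEBRAIC class on every Weil line

Family `hodge`, layer `Literature/AlgebraicGeometry/HodgeTheory`. Generalises `WeilClassesSplitSquare` (`P = x² + d`,
`E = ℚ(√-d)`) and `WeilClassesSplitSquareZetaEight` (`P = x⁴ + 1`, `E = ℚ(ζ₈)`) from those two polynomials to EVERY monic
`P = x^{n+1} + a_n x^n + ⋯ + a_0 ∈ ℤ[x]`: Deligne, LNM 900 (1982), Lemma 4.5 / Remark 4.10 ("`cl(λ)` = image of the class of a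
point of `A₀` under `λ : A₀ ⊗ E → A₀`") on the real carriers, with NO named fact and NO sorry.

## Setting: COMPANION TENSOR STRUCTURES (no product construction is fixed)

`T` a complex abelian variety of dimension `g ≥ 1` (Deligne's `A₀`), `A` an abelian variety with an endomorphism `φ` and
`n + 1` homomorphisms `q₀, …, q_n : A ⟶ T` satisfying the COMPANION RELATIONS of `P`

  `φ ≫ q₀ = -a₀·q_n`,  `φ ≫ q_{j+1} = q_j - a_{j+1}·q_n`  (`j < n`)

— the relations of the coordinate projections of `A₀ ⊗_ℤ ℤ[x]/(P) = A₀^{n+1}` (basis `1, x, …, xⁿ`) with `x` acting by `φ` — a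
SEPARATING endomorphism `u : A ⟶ A` with `u ≫ q_j = 2ʲ·q_j`, and a SECTION `s₀ : T ⟶ A` of `q₀` killing the other `q_j` (both exist
on `A₀^{n+1}`: `u = (x_j ↦ 2ʲx_j)`, `s₀ = (x, 0, …, 0)`). For a complex root `ρ` of `P`:

* `sum_pow_smul_map_mem_eigenspace_of_companion` — `w_ρ(v) := Σ_j ρʲ·q_j^*v` is a `ρ`-EIGENVECTOR of `φ^*` on `H¹(A)` for every
  `v ∈ H¹(T)` (the companion relations and `P(ρ) = 0`);
* `exists_mem_weilLine_algebraic_ne_zero_of_companion` — **the Weil line `pullbackEigenclasses A φ (2g) ((x+yρ)^{2g})` (the summand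
  `⋀^{2g} V_{ℂ,ρ}` of `weilClassesField A φ P (2g) = W_E ⊗ ℂ`, Moonen–Zarhin §1) contains a NON-ZERO ALGEBRAIC class**:
  `P_ρ = ∏ᵢ w_ρ(eᵢ)` over a basis `e` of `H¹(T)`. PROOF (as for `ζ₈`, with `4 ↦ n+1`): `P_ρ = Σ_J ρ^{s(J)} τ_J` over
  `J : Fin 2g → Fin (n+1)`, `s(J) = Σᵢ J(i)`, `τ_J = ∏ᵢ q_{J i}^*eᵢ`; the ALGEBRAIC class `(Σ_j q_j)^*[point] = Σ_J τ_J`; `u^*`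
  acts on `τ_J` by `2^{s(J)}`, so Lagrange projectors in `u^*` (which preserve algebraic classes) extract each
  `σ_s = Σ_{s(J)=s} τ_J`: `P_ρ = Σ_s ρ^s σ_s` is algebraic, and `P_ρ ≠ 0` because `σ₀ = q₀^*[point] ≠ 0` (`s₀`).

What is NOT here: that each Weil line IS `ℂ·P_ρ` and hence `weilClassesField A φ P (2g) ⊆ Nᵍ` (needs `dim A = (n+1)g` and the
`n+1` roots distinct: the eigenspace count of `WeilClassesFieldSplitSquareZetaEight`, file `WeilClassesTensorPointFieldLines`);
the concrete product `A₀^{n+1}` with its companion endomorphism (per field, as for `ζ₈`). Position in the B2b ladder `hodge-weil`: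
instances of the body of rung R3 (`WeilClassesCMField`, `e = n + 1 > 2`) at the tensor points of EVERY CM field — fact-free; not a
rung (special points).

## References

* [Deligne1982HodgeCycles] P. Deligne, LNM 900 (1982), §4 Lemma 4.5, Remark 4.10.
* [MoonenZarhin1998WeilClasses] B. Moonen, Yu. Zarhin, Weil classes on abelian varieties (1998), §1.
* [HatcherAT2002] A. Hatcher, Algebraic Topology (2002), §3.2 Prop. 3.10.
-/

noncomputable section

open CategoryTheory

namespace Literature.AlgebraicGeometry.HodgeTheory

open Literature.AlgebraicTopology.SingularHomology
open Literature.AlgebraicGeometry.Motives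

section HodgeTheory

variable {A T : Motives.AbelianVariety ℂ} {g n : ℕ}

/-! ### Pull-back on `H¹` is `ℤ`-linear in the homomorphism -/

/-- `(f - f')^* = f^* - f'^*` on `H¹`. [cite: LangeBirkenhake1992, 1.1.2 and Lemma 1.1.17 (a)] -/
theorem complexBetti_map_sub_deg_one (f f' : A ⟶ T) (v : complexBetti T.X 1) :
    complexBetti.map (f - f').hom.hom.hom 1 v = complexBetti.map f.hom.hom.hom 1 v - complexBetti.map f'.hom.hom.hom 1 v := by
  rw [sub_eq_add_neg, complexBetti_map_add_deg_one, complexBetti_map_neg_deg_one, ← sub_eq_add_neg]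

/-- `(z • f)^* = z • f^*` on `H¹` (`z : ℤ`). [cite: LangeBirkenhake1992, 1.1.2 and Lemma 1.1.17 (a)] -/
theorem complexBetti_map_zsmul_deg_one (z : ℤ) (f : A ⟶ T) (v : complexBetti T.X 1) :
    complexBetti.map (z • f).hom.hom.hom 1 v = (z : ℂ) • complexBetti.map f.hom.hom.hom 1 v := by
  induction z using Int.induction_on with
  | zero => rw [zero_smul, complexBetti_map_zero_deg_one, Int.cast_zero, zero_smul]
  | succ k ih => rw [add_smul, one_smul, complexBetti_map_add_deg_one, ih, Int.cast_add, Int.cast_one, add_smul, one_smul]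
  | pred k ih =>
    rw [sub_smul, one_smul, complexBetti_map_sub_deg_one, ih, Int.cast_sub, Int.cast_one, sub_smul, one_smul]

/-- `(Σ_j f_j)^* = Σ_j f_j^*` on `H¹`. [cite: LangeBirkenhake1992, 1.1.2 and Lemma 1.1.17 (a)] -/
theorem complexBetti_map_sum_deg_one {ι : Type*} (s : Finset ι) (f : ι → (A ⟶ T)) (v : complexBetti T.X 1) :
    complexBetti.map (∑ j ∈ s, f j).hom.hom.hom 1 v = ∑ j ∈ s, complexBetti.map (f j).hom.hom.hom 1 v := by
  classical
  induction s using Finset.induction_on with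
  | empty => rw [Finset.sum_empty, Finset.sum_empty, complexBetti_map_zero_deg_one]
  | insert j s hj ih => rw [Finset.sum_insert hj, Finset.sum_insert hj, complexBetti_map_add_deg_one, ih]

/-! ### The `ρ`-eigenvectors `w_ρ(v) = Σ_j ρʲ·q_j^* v` of a companion structure -/

variable {φ : A ⟶ A} {q : Fin (n + 1) → (A ⟶ T)} {a : Fin (n + 1) → ℤ} {ρ : ℂ}

/-- **`w_ρ(v) = Σ_j ρʲ·q_j^*v` is a `ρ`-eigenvector of `φ^*` on `H¹(A)`**, for homomorphisms `q_j : A ⟶ T` satisfying the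
companion relations of `P = x^{n+1} + Σ a_j xʲ` for `φ`, and `P(ρ) = 0`:
`φ^* w_ρ(v) = Σ_j ρʲ (φ ≫ q_j)^* v = Σ_{j<n} ρ^{j+1} q_j^* v - P_{<n+1}(ρ)·q_n^* v = ρ·w_ρ(v)`. [cite: Deligne1982HodgeCycles, §4 Lemma 4.5 (proof)] -/
theorem sum_pow_smul_map_mem_eigenspace_of_companion (hq0 : φ ≫ q 0 = -(a 0 • q (Fin.last n)))
    (hqs : ∀ j : Fin n, φ ≫ q j.succ = q (Fin.castSucc j) - a j.succ • q (Fin.last n))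
    (hρ : ρ ^ (n + 1) + ∑ j : Fin (n + 1), (a j : ℂ) * ρ ^ (j : ℕ) = 0) (v : complexBetti T.X 1) :
    ∑ j : Fin (n + 1), ρ ^ (j : ℕ) • complexBetti.map (q j).hom.hom.hom 1 v ∈
      Module.End.eigenspace (complexBetti.map φ.hom.hom.hom 1).hom ρ := by
  rw [Module.End.mem_eigenspace_iff]
  change complexBetti.map φ.hom.hom.hom 1 _ = _
  have h0 : complexBetti.map φ.hom.hom.hom 1 (complexBetti.map (q 0).hom.hom.hom 1 v) =
      -((a 0 : ℂ) • complexBetti.map (q (Fin.last n)).hom.hom.hom 1 v) := by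
    rw [complexBetti_map_map_hom, hq0, complexBetti_map_neg_deg_one, complexBetti_map_zsmul_deg_one]
  have hs : ∀ j : Fin n, complexBetti.map φ.hom.hom.hom 1 (complexBetti.map (q j.succ).hom.hom.hom 1 v) =
      complexBetti.map (q (Fin.castSucc j)).hom.hom.hom 1 v -
        (a j.succ : ℂ) • complexBetti.map (q (Fin.last n)).hom.hom.hom 1 v := by
    intro j
    rw [complexBetti_map_map_hom, hqs, complexBetti_map_sub_deg_one, complexBetti_map_zsmul_deg_one]
  -- the coefficient of `q_n^* v`: `-(a₀ + Σ_j a_{j+1} ρ^{j+1}) = ρ^{n+1}` by `P(ρ) = 0`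
  have hcoef : -(a 0 : ℂ) - ∑ j : Fin n, ρ ^ ((j : ℕ) + 1) * (a j.succ : ℂ) = ρ ^ (n + 1) := by
    have h := hρ
    rw [Fin.sum_univ_succ] at h
    simp only [Fin.val_zero, pow_zero, mul_one, Fin.val_succ] at h
    have e : ∑ j : Fin n, ρ ^ ((j : ℕ) + 1) * (a j.succ : ℂ) = ∑ j : Fin n, (a j.succ : ℂ) * ρ ^ ((j : ℕ) + 1) :=
      Finset.sum_congr rfl fun j _ => mul_comm _ _
    rw [e]
    linear_combination -h
  -- left side: split off `j = 0`, use the relations; right side: split off `j = last`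
  rw [map_sum, Fin.sum_univ_succ]
  simp only [map_smul, Fin.val_zero, pow_zero, one_smul, Fin.val_succ, h0, hs, smul_sub, smul_smul,
    Finset.sum_sub_distrib]
  rw [Finset.smul_sum, Fin.sum_univ_castSucc]
  simp only [smul_smul, Fin.val_castSucc, Fin.val_last, ← pow_succ', ← Finset.sum_smul]
  rw [← hcoef, sub_smul, neg_smul]
  abel

/-! ### The main theorem: a non-zero algebraic class on the Weil line of `ρ` -/

/-- **Deligne's Lemma 4.5 for every `P`: the Weil line of a root `ρ` of `P` contains a non-zero ALGEBRAIC class.** For a companion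
tensor structure `(A, φ, q₀..q_n)` of `P = x^{n+1} + Σ a_j xʲ` over `T` (`dim T = g ≥ 1`) with a separating endomorphism `u`
(`u ≫ q_j = 2ʲ·q_j`) and a section `s₀` of `q₀` killing `q₁..q_n`, and every root `ρ` of `P`: there is
`P_ρ ∈ pullbackEigenclasses A φ (2g) ((x + yρ)^{2g})`, algebraic and non-zero (`P_ρ = ∏ᵢ w_ρ(eᵢ)`; module docstring).
[cite: Deligne1982HodgeCycles, §4 Lemma 4.5 and Remark 4.10] [cite: HatcherAT2002, §3.2 Prop. 3.10] -/
theorem exists_mem_weilLine_algebraic_ne_zero_of_companion (hg : 0 < g) (hT : T.dim = g)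
    (hq0 : φ ≫ q 0 = -(a 0 • q (Fin.last n)))
    (hqs : ∀ j : Fin n, φ ≫ q j.succ = q (Fin.castSucc j) - a j.succ • q (Fin.last n))
    {u : A ⟶ A} (hu : ∀ j : Fin (n + 1), u ≫ q j = (2 ^ (j : ℕ)) • q j)
    {s₀ : T ⟶ A} (hs₀ : s₀ ≫ q 0 = 𝟙 T)
    (hρ : ρ ^ (n + 1) + ∑ j : Fin (n + 1), (a j : ℂ) * ρ ^ (j : ℕ) = 0) :
    ∃ P ∈ pullbackEigenclasses A φ (2 * g) (fun x y => ((x : ℂ) + (y : ℂ) * ρ) ^ (2 * g)),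
      P ∈ algebraicClasses A.X g ∧ P ≠ 0 := by
  classical
  have hX : IsSmoothProjective g T.X := Motives.isSmoothProjective_of_dim_eq' hT
  have hXA : IsSmoothProjective A.dim A.X := Motives.isSmoothProjective_of_dim_eq' rfl
  -- a basis of `H¹(T)`, the top class `t`
  haveI := finite_complexBetti_abelianVariety T 1
  have hb₁T : Module.finrank ℂ (complexBetti T.X 1) = 2 * g := by
    rw [AbelianVariety.finrank_complexBetti_one, hT]
  let e : Module.Basis (Fin (2 * g)) ℂ (complexBetti T.X 1) := Module.finBasisOfFinrankEq ℂ _ hb₁T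
  have hΛT := AbelianVariety.hasExteriorCohomologyH1_complexPoints T
  set t : complexBetti T.X (2 * g) := cupPowOne ℂ (Motives.ComplexPoints T.X) (2 * g) e with htdef
  have ht0 : t ≠ 0 := cupPowOne_basis_ne_zero hΛT e
  have ht_alg : t ∈ algebraicClasses T.X g := mem_algebraicClasses_of_degree_top hX hg t
  -- the families `f j i = qⱼ^* eᵢ`, the eigenvector family `W` and the class `P`
  let f : Fin (n + 1) → Fin (2 * g) → complexBetti A.X 1 := fun j i => complexBetti.map (q j).hom.hom.hom 1 (e i)
  let W : Fin (2 * g) → complexBetti A.X 1 := fun i => ∑ j : Fin (n + 1), ρ ^ (j : ℕ) • f j i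
  set P : complexBetti A.X (2 * g) := cupPowOne ℂ (Motives.ComplexPoints A.X) (2 * g) W with hPdef
  have hPeig : P ∈ pullbackEigenclasses A φ (2 * g) (fun x y => ((x : ℂ) + (y : ℂ) * ρ) ^ (2 * g)) := by
    have hWe : ∀ i, W i ∈ Module.End.eigenspace (complexBetti.map φ.hom.hom.hom 1).hom ρ := fun i =>
      sum_pow_smul_map_mem_eigenspace_of_companion hq0 hqs hρ (e i)
    have h := cupPowOne_mem_pullbackEigenclasses (lam := fun _ => ρ) (v := W) hWe
    have eχ : (fun x y : ℕ => ∏ _i : Fin (2 * g), ((x : ℂ) + (y : ℂ) * ρ)) =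
        fun x y : ℕ => ((x : ℂ) + (y : ℂ) * ρ) ^ (2 * g) := by
      funext x y; rw [Finset.prod_const, Finset.card_univ, Fintype.card_fin]
    rw [← eχ]
    exact h
  -- the terms `τ_J`, `J : Fin 2g → Fin (n+1)`, and the two expansions
  let τ : (Fin (2 * g) → Fin (n + 1)) → complexBetti A.X (2 * g) := fun J =>
    cupPowOne ℂ (Motives.ComplexPoints A.X) (2 * g) (fun i => f (J i) i)
  let sJ : (Fin (2 * g) → Fin (n + 1)) → ℕ := fun J => ∑ i, (J i : ℕ)
  have hP_sum : P = ∑ J : Fin (2 * g) → Fin (n + 1), ρ ^ sJ J • τ J := by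
    rw [hPdef]
    change cupPowOne ℂ _ (2 * g) (fun i => ∑ j ∈ (Finset.univ : Finset (Fin (n + 1))), ρ ^ (j : ℕ) • f j i) = _
    rw [MultilinearMap.map_sum_finset, Fintype.piFinset_univ]
    refine Finset.sum_congr rfl fun J _ => ?_
    rw [MultilinearMap.map_smul_univ, Finset.prod_pow_eq_pow_sum]
  set m : A ⟶ T := ∑ j : Fin (n + 1), q j with hmdef
  have hmt : complexBetti.map m.hom.hom.hom (2 * g) t = ∑ J : Fin (2 * g) → Fin (n + 1), τ J := by
    rw [htdef, complexBetti_map_cupPowOne]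
    have e1 : (fun i => complexBetti.map m.hom.hom.hom 1 (e i)) =
        fun i => ∑ j ∈ (Finset.univ : Finset (Fin (n + 1))), f j i := by
      funext i
      rw [hmdef, complexBetti_map_sum_deg_one]
    rw [e1, MultilinearMap.map_sum_finset, Fintype.piFinset_univ]
  have hmt_alg : complexBetti.map m.hom.hom.hom (2 * g) t ∈ algebraicClasses A.X g :=
    map_mem_algebraicClasses_of_abelianVariety hXA T m.hom.hom.hom ht_alg
  -- the separating endomorphism `u`: `u^* τ_J = 2^{s(J)} τ_J`
  have huf : ∀ j i, complexBetti.map u.hom.hom.hom 1 (f j i) = ((2 : ℂ) ^ (j : ℕ)) • f j i := by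
    intro j i
    change complexBetti.map u.hom.hom.hom 1 (complexBetti.map (q j).hom.hom.hom 1 (e i)) = _
    rw [complexBetti_map_map_hom, hu, complexBetti_map_nsmul_deg_one, ← Nat.cast_smul_eq_nsmul ℂ, Nat.cast_pow,
      Nat.cast_ofNat]
  let U : complexBetti A.X (2 * g) →ₗ[ℂ] complexBetti A.X (2 * g) := (complexBetti.map u.hom.hom.hom (2 * g)).hom
  have hUτ : ∀ J, U (τ J) = (2 : ℂ) ^ sJ J • τ J := by
    intro J
    change complexBetti.map u.hom.hom.hom (2 * g) (cupPowOne ℂ _ (2 * g) (fun i => f (J i) i)) = _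
    rw [complexBetti_map_cupPowOne]
    have hfun : (fun i => complexBetti.map u.hom.hom.hom 1 (f (J i) i)) =
        fun i => ((2 : ℂ) ^ ((J i : Fin (n + 1)) : ℕ)) • f (J i) i := by
      funext i; exact huf (J i) i
    rw [hfun, MultilinearMap.map_smul_univ, Finset.prod_pow_eq_pow_sum]
  have hU_alg : ∀ w ∈ algebraicClasses A.X g, U w ∈ algebraicClasses A.X g := fun w hw =>
    map_mem_algebraicClasses_of_abelianVariety hXA A u.hom.hom.hom hw
  -- the projectors `Q_s`, `s ≤ n·(2g)`
  have hsJ_le : ∀ J, sJ J ≤ n * (2 * g) := by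
    intro J
    change ∑ i, (J i : ℕ) ≤ _
    calc ∑ i, (J i : ℕ) ≤ ∑ _i : Fin (2 * g), n := Finset.sum_le_sum fun i _ => Nat.le_of_lt_succ (J i).isLt
      _ = n * (2 * g) := by rw [Finset.sum_const, Finset.card_univ, Fintype.card_fin, smul_eq_mul, mul_comm]
  let ε : ℕ → ℕ → ℂ := fun k r => if r = k then 0 else (2 : ℂ) ^ r
  let Q : ℕ → (complexBetti A.X (2 * g) →ₗ[ℂ] complexBetti A.X (2 * g)) := fun k =>
    ((List.range (n * (2 * g) + 1)).map fun r => U - ε k r • (LinearMap.id : _ →ₗ[ℂ] _)).prod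
  have hQ_alg : ∀ k, ∀ {w : complexBetti A.X (2 * g)}, w ∈ algebraicClasses A.X g →
      Q k w ∈ algebraicClasses A.X g :=
    fun k _ hw => listProd_sub_smul_apply_mem (fun _ => U) (ε k) (algebraicClasses A.X g)
      (fun _ w hw => hU_alg w hw) (n * (2 * g) + 1) hw
  have hQτ : ∀ k J, Q k (τ J) = (∏ r ∈ Finset.range (n * (2 * g) + 1), ((2 : ℂ) ^ sJ J - ε k r)) • τ J :=
    fun k J => listProd_sub_smul_apply_of_eigen (fun _ => U) (ε k) (fun _ => (2 : ℂ) ^ sJ J) (τ J)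
      (fun _ => hUτ J) (n * (2 * g) + 1)
  have hpow_inj : ∀ a b : ℕ, (2 : ℂ) ^ a = (2 : ℂ) ^ b → a = b := by
    intro a b h
    exact Nat.pow_right_injective le_rfl (by exact_mod_cast h)
  have hQτ_ne : ∀ k J, sJ J ≠ k → Q k (τ J) = 0 := by
    intro k J hk
    rw [hQτ]
    have hmem : sJ J ∈ Finset.range (n * (2 * g) + 1) :=
      Finset.mem_range.mpr (Nat.lt_succ_of_le (hsJ_le J))
    rw [Finset.prod_eq_zero hmem (by simp only [ε, if_neg hk, sub_self]), zero_smul]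
  have hκ : ∀ k, (∏ r ∈ Finset.range (n * (2 * g) + 1), ((2 : ℂ) ^ k - ε k r)) ≠ 0 := by
    intro k
    rw [Finset.prod_ne_zero_iff]
    intro r _
    by_cases hr : r = k
    · simp only [ε, if_pos hr, sub_zero]; exact pow_ne_zero _ two_ne_zero
    · simp only [ε, if_neg hr]
      exact sub_ne_zero.mpr fun h => hr (hpow_inj _ _ h).symm
  -- `σ_k = Σ_{s(J) = k} τ_J` is algebraic
  have hσ_alg : ∀ k, (∑ J ∈ Finset.univ.filter (fun J : Fin (2 * g) → Fin (n + 1) => sJ J = k), τ J) ∈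
      algebraicClasses A.X g := by
    intro k
    have hQmt : Q k (complexBetti.map m.hom.hom.hom (2 * g) t) =
        (∏ r ∈ Finset.range (n * (2 * g) + 1), ((2 : ℂ) ^ k - ε k r)) •
          ∑ J ∈ Finset.univ.filter (fun J : Fin (2 * g) → Fin (n + 1) => sJ J = k), τ J := by
      rw [hmt, map_sum, Finset.smul_sum, ← Finset.sum_filter_add_sum_filter_not Finset.univ
        (fun J : Fin (2 * g) → Fin (n + 1) => sJ J = k)]
      rw [Finset.sum_eq_zero (s := Finset.univ.filter fun J : Fin (2 * g) → Fin (n + 1) => ¬sJ J = k)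
        (fun J hJ => hQτ_ne k J (Finset.mem_filter.mp hJ).2), add_zero]
      refine Finset.sum_congr rfl fun J hJ => ?_
      rw [hQτ, (Finset.mem_filter.mp hJ).2]
    have h := hQ_alg k hmt_alg
    rw [hQmt] at h
    simpa only [inv_smul_smul₀ (hκ k)] using (algebraicClasses A.X g).smul_mem
      (∏ r ∈ Finset.range (n * (2 * g) + 1), ((2 : ℂ) ^ k - ε k r))⁻¹ h
  -- hence `P` is algebraic
  have hP_alg : P ∈ algebraicClasses A.X g := by
    rw [hP_sum, ← Finset.sum_fiberwise_of_maps_to (s := Finset.univ) (t := Finset.range (n * (2 * g) + 1))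
      (g := sJ) (fun J _ => Finset.mem_range.mpr (Nat.lt_succ_of_le (hsJ_le J)))]
    refine Submodule.sum_mem _ fun k _ => ?_
    have hk : (∑ J ∈ Finset.univ.filter (fun J : Fin (2 * g) → Fin (n + 1) => sJ J = k), ρ ^ sJ J • τ J) =
        ρ ^ k • ∑ J ∈ Finset.univ.filter (fun J : Fin (2 * g) → Fin (n + 1) => sJ J = k), τ J := by
      rw [Finset.smul_sum]
      refine Finset.sum_congr rfl fun J hJ => ?_
      rw [(Finset.mem_filter.mp hJ).2]
    rw [hk]
    exact (algebraicClasses A.X g).smul_mem _ (hσ_alg k)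
  -- and non-zero: the `s = 0` class is `q₀^* t ≠ 0`
  have hs0 : ∀ J : Fin (2 * g) → Fin (n + 1), sJ J = 0 → J = fun _ => 0 := by
    intro J hJ
    funext i
    have hi : ((J i : Fin (n + 1)) : ℕ) = 0 := Finset.sum_eq_zero_iff.mp hJ i (Finset.mem_univ i)
    exact Fin.ext hi
  have hτ0 : τ (fun _ => 0) = complexBetti.map (q 0).hom.hom.hom (2 * g) t := by
    change cupPowOne ℂ _ (2 * g) (fun i => f 0 i) = _
    rw [htdef, complexBetti_map_cupPowOne]
  have hq0t : complexBetti.map (q 0).hom.hom.hom (2 * g) t ≠ 0 := by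
    intro h0
    apply ht0
    have : complexBetti.map s₀.hom.hom.hom (2 * g) (complexBetti.map (q 0).hom.hom.hom (2 * g) t) = t := by
      rw [complexBetti_map_map_hom, hs₀]
      exact abelianVariety_map_id_apply t
    rw [← this, h0, map_zero]
  have hP0 : P ≠ 0 := by
    intro hP
    have h := congrArg (Q 0) hP_sum
    rw [hP, map_zero, map_sum, Finset.sum_eq_single (fun _ : Fin (2 * g) => (0 : Fin (n + 1)))] at h
    · have hs00 : sJ (fun _ => 0) = 0 := by
        change ∑ i : Fin (2 * g), ((0 : Fin (n + 1)) : ℕ) = 0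
        rw [Fin.val_zero, Finset.sum_const_zero]
      rw [map_smul, hQτ, hs00, pow_zero, one_smul, hτ0] at h
      exact (smul_ne_zero (hκ 0) hq0t) h.symm
    · intro J _ hJ
      rw [map_smul, hQτ_ne 0 J (fun hc' => hJ (hs0 J hc')), smul_zero]
    · intro h'; exact absurd (Finset.mem_univ _) h'
  exact ⟨P, hPeig, hP_alg, hP0⟩

end HodgeTheory

end Literature.AlgebraicGeometry.HodgeTheory

end
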